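import Mathlib
import Literature.Computability.AlgebraicComplexity.PrattTrapezoidVal
import Literature.Computability.AlgebraicComplexity.PrattTrapezoidValBounds
import Summits.MatrixMultiplication.MatrixMultiplication.Theorems.EisensteinValCertificatesPrimeValSavingPointwiseLoads

/-!
# Disjoint squares, translates and dense pairs for equilateral trapezoid-free triples

Companion of `…PrimeValSavingPointwiseLoads` (support for route
`MatrixMultiplication/EisensteinValCertificates`, cruxes `stmt-MatrixMultiplication-7788`
`PrimeValSaving` and stmt-7790 `PrimeFourThirdsSaving`).  Notation as there: a *point* of the triple
`(A, B, C)` is a solution of `a + b + c = 0`, lying on the `A`-line `a`, the `B`-line `b`, the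
`C`-line `c`; `r(c) = #{a ∈ A : -(a+c) ∈ B}` is the load of the `C`-line `c`, `d_A(a)`, `d_B(b)`
likewise.  All statements hold in every (finite, where `|G|` occurs) abelian group.

* `card_A_through_C_eq`, … — the two line families through one line are equinumerous.
* **Disjoint squares** (Prop. 3.1 unfolded): the rectangles
  `{a ∈ A : -(a+c) ∈ B} × {b ∈ B : -(b+c) ∈ A}`, `c ∈ C`, are pairwise disjoint in `A × B`, hence
  `∑_{c∈C} r(c)² ≤ #A·#B` (`sum_mul_C_le`, `sum_sq_C_le`); likewise `∑_b d_B(b)² ≤ #A·#C`,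
  `∑_a d_A(a)² ≤ #B·#C`.  (The tree's `IsEquilateralTrapezoidFree.card_zeroSumTriples_sq_le` is the
  Cauchy–Schwarz consequence `T² ≤ #A·#B·#C`; the three sums themselves were not exported.)
* `card_zeroSumTriples_eq_sum_C`, `card_zeroSumTriples_eq_sum_A` — the number `T` of points as a
  total load.
* **Translates are trivial**: if `B = A + t` then every `A`-line carries at most one point and
  `T ≤ #A` (`card_zeroSumTriples_le_card_of_translate`) — no translation-symmetric ansatz beats the
  trivial triple `(G, {0}, G)`; by the `S₃`-symmetry the same holds for any two of the three sets.
* **Dense pairs are linear**: `r(c) ≥ #A + #B − |G|` for every `C`-line, so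
  `(#A + #B)·T ≤ |G|·T + #A·#B` (`card_mul_le_of_dense`); e.g. `#A + #B ≥ (1+ε)|G|` forces
  `T ≤ |G|/ε`, and `T ≥ |G|^{1+c}` forces `#A + #B ≤ |G| + #A·#B/T ≤ |G| + |G|^{1-c}` for each of the
  three pairs.

[cite: Pratt2024, Def. 3.2, Prop. 3.1, Prop. 3.4]
-/

-- single-conjunct summit: the mandated namespace repeats `MatrixMultiplication`.
set_option linter.dupNamespace false

namespace Summit.MatrixMultiplication.MatrixMultiplication.Theorems

namespace PrattValDisjointSquares

open Finset Literature.Computability.AlgebraicComplexity PrattValPointwiseLoads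

variable {G : Type*} [AddCommGroup G] [DecidableEq G] {A B C : Finset G}

/-! ### The two line sets through one line have the same size -/

/-- The `A`-lines and the `B`-lines through a `C`-line `c` correspond bijectively
(`a ↦ -(a + c)`). [folklore] -/
theorem card_A_through_C_eq (c : G) :
    #(A.filter fun a => -(a + c) ∈ B) = #(B.filter fun b => -(b + c) ∈ A) := by
  refine card_bij' (fun a _ => -(a + c)) (fun b _ => -(b + c)) ?_ ?_ ?_ ?_
  · intro a ha
    simp only [mem_filter] at ha ⊢
    refine ⟨ha.2, ?_⟩
    have : -(-(a + c) + c) = a := by abel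
    rw [this]; exact ha.1
  · intro b hb
    simp only [mem_filter] at hb ⊢
    refine ⟨hb.2, ?_⟩
    have : -(-(b + c) + c) = b := by abel
    rw [this]; exact hb.1
  · intro a _; abel
  · intro b _; abel

/-- The `B`-lines and the `C`-lines through an `A`-line `a` correspond bijectively
(`b ↦ -(a + b)`). [folklore] -/
theorem card_B_through_A_eq (a : G) :
    #(B.filter fun b => -(a + b) ∈ C) = #(C.filter fun c => -(a + c) ∈ B) := by
  refine card_bij' (fun b _ => -(a + b)) (fun c _ => -(a + c)) ?_ ?_ ?_ ?_
  · intro b hb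
    simp only [mem_filter] at hb ⊢
    refine ⟨hb.2, ?_⟩
    have : -(a + -(a + b)) = b := by abel
    rw [this]; exact hb.1
  · intro c hc
    simp only [mem_filter] at hc ⊢
    refine ⟨hc.2, ?_⟩
    have : -(a + -(a + c)) = c := by abel
    rw [this]; exact hc.1
  · intro b _; abel
  · intro c _; abel

/-- The `A`-lines and the `C`-lines through a `B`-line `b` correspond bijectively
(`a ↦ -(a + b)`). [folklore] -/
theorem card_A_through_B_eq (b : G) :
    #(A.filter fun a => -(a + b) ∈ C) = #(C.filter fun c => -(b + c) ∈ A) := by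
  refine card_bij' (fun a _ => -(a + b)) (fun c _ => -(b + c)) ?_ ?_ ?_ ?_
  · intro a ha
    simp only [mem_filter] at ha ⊢
    refine ⟨ha.2, ?_⟩
    have : -(b + -(a + b)) = a := by abel
    rw [this]; exact ha.1
  · intro c hc
    simp only [mem_filter] at hc ⊢
    refine ⟨hc.2, ?_⟩
    have : -(-(b + c) + b) = c := by abel
    rw [this]; exact hc.1
  · intro a _; abel
  · intro c _; abel

/-! ### Disjoint squares: the three Cauchy–Schwarz sums of Prop. 3.1 -/

/-- **Squares bound, system 1.** The rectangles `{a ∈ A : -(a+c) ∈ B} × {b ∈ B : -(b+c) ∈ A}`,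
`c ∈ C`, are pairwise disjoint subsets of `A × B`; hence `∑_{c ∈ C} r_A(c) · r_B(c) ≤ #A · #B`.
[cite: Pratt2024, Prop. 3.1 (proof)] -/
theorem sum_mul_C_le (h : IsEquilateralTrapezoidFree A B C) :
    ∑ c ∈ C, #(A.filter fun a => -(a + c) ∈ B) * #(B.filter fun b => -(b + c) ∈ A) ≤ #A * #B := by
  have key : ∑ c ∈ C, #((A.filter fun a => -(a + c) ∈ B) ×ˢ (B.filter fun b => -(b + c) ∈ A))
      ≤ #(A ×ˢ B) := by
    rw [← card_biUnion]
    · exact card_le_card (biUnion_subset.2 fun c _ =>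
        product_subset_product (filter_subset _ _) (filter_subset _ _))
    · intro c₁ hc₁ c₂ hc₂ hne
      refine Finset.disjoint_left.2 fun q hq₁ hq₂ => hne ?_
      simp only [mem_product, mem_filter] at hq₁ hq₂
      by_contra hne'
      exact Finset.disjoint_left.1
        (disjoint_A_of_C_lines_through_B h hq₁.2.1 (mem_coe.1 hc₁) (mem_coe.1 hc₂) hq₁.2.2
          hq₂.2.2 hne') (mem_filter.2 hq₁.1) (mem_filter.2 hq₂.1)
  simpa only [card_product] using key

/-- **Squares bound, system 1 (square form)**: `∑_{c ∈ C} r(c)² ≤ #A · #B`, where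
`r(c) = #{a ∈ A : -(a+c) ∈ B}` is the number of points on the `C`-line `c`.
[cite: Pratt2024, Prop. 3.1] -/
theorem sum_sq_C_le (h : IsEquilateralTrapezoidFree A B C) :
    ∑ c ∈ C, #(A.filter fun a => -(a + c) ∈ B) ^ 2 ≤ #A * #B := by
  calc ∑ c ∈ C, #(A.filter fun a => -(a + c) ∈ B) ^ 2
      = ∑ c ∈ C, #(A.filter fun a => -(a + c) ∈ B) * #(B.filter fun b => -(b + c) ∈ A) :=
        sum_congr rfl fun c _ => by rw [sq, card_A_through_C_eq]
    _ ≤ #A * #B := sum_mul_C_le h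

/-- **Squares bound, system 2.** The rectangles `{a ∈ A : -(a+b) ∈ C} × {c ∈ C : -(b+c) ∈ A}`,
`b ∈ B`, are pairwise disjoint subsets of `A × C`. [cite: Pratt2024, Prop. 3.1 (proof)] -/
theorem sum_mul_B_le (h : IsEquilateralTrapezoidFree A B C) :
    ∑ b ∈ B, #(A.filter fun a => -(a + b) ∈ C) * #(C.filter fun c => -(b + c) ∈ A) ≤ #A * #C := by
  have key : ∑ b ∈ B, #((A.filter fun a => -(a + b) ∈ C) ×ˢ (C.filter fun c => -(b + c) ∈ A))
      ≤ #(A ×ˢ C) := by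
    rw [← card_biUnion]
    · exact card_le_card (biUnion_subset.2 fun b _ =>
        product_subset_product (filter_subset _ _) (filter_subset _ _))
    · intro b₁ hb₁ b₂ hb₂ hne
      refine Finset.disjoint_left.2 fun q hq₁ hq₂ => hne ?_
      simp only [mem_product, mem_filter] at hq₁ hq₂
      by_contra hne'
      exact Finset.disjoint_left.1
        (disjoint_A_of_B_lines_through_C h hq₁.2.1 (mem_coe.1 hb₁) (mem_coe.1 hb₂) hq₁.2.2
          hq₂.2.2 hne') (mem_filter.2 hq₁.1) (mem_filter.2 hq₂.1)
  simpa only [card_product] using key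

/-- **Squares bound, system 2 (square form)**: `∑_{b ∈ B} d_B(b)² ≤ #A · #C`, where
`d_B(b) = #{a ∈ A : -(a+b) ∈ C}` is the number of points on the `B`-line `b`.
[cite: Pratt2024, Prop. 3.1] -/
theorem sum_sq_B_le (h : IsEquilateralTrapezoidFree A B C) :
    ∑ b ∈ B, #(A.filter fun a => -(a + b) ∈ C) ^ 2 ≤ #A * #C := by
  calc ∑ b ∈ B, #(A.filter fun a => -(a + b) ∈ C) ^ 2
      = ∑ b ∈ B, #(A.filter fun a => -(a + b) ∈ C) * #(C.filter fun c => -(b + c) ∈ A) :=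
        sum_congr rfl fun b _ => by rw [sq, card_A_through_B_eq]
    _ ≤ #A * #C := sum_mul_B_le h

/-- **Squares bound, system 3.** The rectangles `{b ∈ B : -(a+b) ∈ C} × {c ∈ C : -(a+c) ∈ B}`,
`a ∈ A`, are pairwise disjoint subsets of `B × C`. [cite: Pratt2024, Prop. 3.1 (proof)] -/
theorem sum_mul_A_le (h : IsEquilateralTrapezoidFree A B C) :
    ∑ a ∈ A, #(B.filter fun b => -(a + b) ∈ C) * #(C.filter fun c => -(a + c) ∈ B) ≤ #B * #C := by
  have key : ∑ a ∈ A, #((B.filter fun b => -(a + b) ∈ C) ×ˢ (C.filter fun c => -(a + c) ∈ B))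
      ≤ #(B ×ˢ C) := by
    rw [← card_biUnion]
    · exact card_le_card (biUnion_subset.2 fun a _ =>
        product_subset_product (filter_subset _ _) (filter_subset _ _))
    · intro a₁ ha₁ a₂ ha₂ hne
      refine Finset.disjoint_left.2 fun q hq₁ hq₂ => hne ?_
      simp only [mem_product, mem_filter] at hq₁ hq₂
      by_contra hne'
      exact Finset.disjoint_left.1
        (disjoint_B_of_A_lines_through_C h hq₁.2.1 (mem_coe.1 ha₁) (mem_coe.1 ha₂) hq₁.2.2
          hq₂.2.2 hne') (mem_filter.2 hq₁.1) (mem_filter.2 hq₂.1)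
  simpa only [card_product] using key

/-- **Squares bound, system 3 (square form)**: `∑_{a ∈ A} d_A(a)² ≤ #B · #C`, where
`d_A(a) = #{b ∈ B : -(a+b) ∈ C}` is the number of points on the `A`-line `a`.
[cite: Pratt2024, Prop. 3.1] -/
theorem sum_sq_A_le (h : IsEquilateralTrapezoidFree A B C) :
    ∑ a ∈ A, #(B.filter fun b => -(a + b) ∈ C) ^ 2 ≤ #B * #C := by
  calc ∑ a ∈ A, #(B.filter fun b => -(a + b) ∈ C) ^ 2
      = ∑ a ∈ A, #(B.filter fun b => -(a + b) ∈ C) * #(C.filter fun c => -(a + c) ∈ B) :=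
        sum_congr rfl fun a _ => by rw [sq, card_B_through_A_eq]
    _ ≤ #B * #C := sum_mul_A_le h

/-! ### The number of points, fibred over one direction -/

/-- The number of solutions is the total load of the `C`-lines:
`#(zeroSumTriples A B C) = ∑_{c ∈ C} #{a ∈ A : -(a+c) ∈ B}`. [folklore] -/
theorem card_zeroSumTriples_eq_sum_C (A B C : Finset G) :
    #(zeroSumTriples A B C) = ∑ c ∈ C, #(A.filter fun a => -(a + c) ∈ B) := by
  have hmaps : Set.MapsTo (fun t : G × G × G => t.2.2) (zeroSumTriples A B C : Set (G × G × G))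
      (C : Set G) := fun t ht => mem_coe.2 (mem_zeroSumTriples.1 (mem_coe.1 ht)).1.2.2
  rw [card_eq_sum_card_fiberwise hmaps]
  refine sum_congr rfl fun c hc => ?_
  refine card_bij' (fun t _ => t.1) (fun a _ => (a, -(a + c), c)) ?_ ?_ ?_ ?_
  · intro t ht
    obtain ⟨ht, htc⟩ := mem_filter.1 ht
    obtain ⟨⟨ha, hb, -⟩, hsum⟩ := mem_zeroSumTriples.1 ht
    refine mem_filter.2 ⟨ha, ?_⟩
    have key : -(t.1 + c) = t.2.1 := by
      rw [← htc, neg_eq_iff_add_eq_zero, ← hsum]; abel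
    rw [key]; exact hb
  · intro a ha
    obtain ⟨ha, hb⟩ := mem_filter.1 ha
    refine mem_filter.2 ⟨mem_zeroSumTriples.2 ⟨⟨ha, hb, hc⟩, ?_⟩, rfl⟩
    show a + -(a + c) + c = 0
    abel
  · intro t ht
    obtain ⟨ht, htc⟩ := mem_filter.1 ht
    obtain ⟨-, hsum⟩ := mem_zeroSumTriples.1 ht
    refine Prod.ext rfl (Prod.ext ?_ htc.symm)
    show -(t.1 + c) = t.2.1
    rw [← htc, neg_eq_iff_add_eq_zero, ← hsum]; abel
  · intro a _; rfl

/-- The number of solutions is the total load of the `A`-lines: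
`#(zeroSumTriples A B C) = ∑_{a ∈ A} #{b ∈ B : -(a+b) ∈ C}`. [folklore] -/
theorem card_zeroSumTriples_eq_sum_A (A B C : Finset G) :
    #(zeroSumTriples A B C) = ∑ a ∈ A, #(B.filter fun b => -(a + b) ∈ C) := by
  have hmaps : Set.MapsTo (fun t : G × G × G => t.1) (zeroSumTriples A B C : Set (G × G × G))
      (A : Set G) := fun t ht => mem_coe.2 (mem_zeroSumTriples.1 (mem_coe.1 ht)).1.1
  rw [card_eq_sum_card_fiberwise hmaps]
  refine sum_congr rfl fun a ha => ?_
  refine card_bij' (fun t _ => t.2.1) (fun b _ => (a, b, -(a + b))) ?_ ?_ ?_ ?_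
  · intro t ht
    obtain ⟨ht, hta⟩ := mem_filter.1 ht
    obtain ⟨⟨-, hb, hc'⟩, hsum⟩ := mem_zeroSumTriples.1 ht
    refine mem_filter.2 ⟨hb, ?_⟩
    have key : -(a + t.2.1) = t.2.2 := by
      rw [← hta, neg_eq_iff_add_eq_zero, ← hsum]
    rw [key]; exact hc'
  · intro b hb
    obtain ⟨hb, hc'⟩ := mem_filter.1 hb
    refine mem_filter.2 ⟨mem_zeroSumTriples.2 ⟨⟨ha, hb, hc'⟩, ?_⟩, rfl⟩
    show a + b + -(a + b) = 0
    abel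
  · intro t ht
    obtain ⟨ht, hta⟩ := mem_filter.1 ht
    obtain ⟨-, hsum⟩ := mem_zeroSumTriples.1 ht
    refine Prod.ext hta.symm (Prod.ext rfl ?_)
    show -(a + t.2.1) = t.2.2
    rw [← hta, neg_eq_iff_add_eq_zero, ← hsum]
  · intro b _; rfl

/-! ### Translates are trivial -/

/-- **Translation-symmetric triples are trivial.** If `B = A + t` (every `a + t ∈ B` and every
`b - t ∈ A`), then every `A`-line carries at most one point: two points `(a, bᵢ, cᵢ)` would be two
solutions of system 1 with `a' = a`, `b' = a + t`, namely `(bᵢ - t, bᵢ, cᵢ)`.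
[cite: Pratt2024, Def. 3.2 (system 1)] -/
theorem card_B_through_A_le_one_of_translate (h : IsEquilateralTrapezoidFree A B C) {t : G}
    (hAB : ∀ a ∈ A, a + t ∈ B) (hBA : ∀ b ∈ B, b - t ∈ A) {a : G} (ha : a ∈ A) :
    #(B.filter fun b => -(a + b) ∈ C) ≤ 1 := by
  refine Finset.card_le_one.2 fun b₁ hb₁ b₂ hb₂ => ?_
  simp only [mem_filter] at hb₁ hb₂
  exact (sys₁_eq h ha (hAB a ha) (hBA b₁ hb₁.1) hb₁.1 hb₁.2 (hBA b₂ hb₂.1) hb₂.1 hb₂.2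
    (add_neg_cancel _) (by abel) (add_neg_cancel _) (by abel)).2.1

/-- **Translation-symmetric triples are trivial (count).** If `B = A + t` then a trapezoid-free
triple `(A, B, C)` has at most `#A` solutions of `a + b + c = 0` — no more than the trivial
triple `(G, {0}, G)` relative to its first set. [cite: Pratt2024, Def. 3.2, Prop. 3.4] -/
theorem card_zeroSumTriples_le_card_of_translate (h : IsEquilateralTrapezoidFree A B C) {t : G}
    (hAB : ∀ a ∈ A, a + t ∈ B) (hBA : ∀ b ∈ B, b - t ∈ A) :
    #(zeroSumTriples A B C) ≤ #A := by
  rw [card_zeroSumTriples_eq_sum_A]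
  calc ∑ a ∈ A, #(B.filter fun b => -(a + b) ∈ C) ≤ ∑ a ∈ A, 1 :=
        sum_le_sum fun a ha => card_B_through_A_le_one_of_translate h hAB hBA ha
    _ = #A := by simp

/-! ### Dense pairs are linear -/

/-- Every `C`-line meets at least `#A + #B - |G|` `A`-lines: `{a ∈ A : -(a+c) ∈ B}` is
`A ∩ (-c - B)` and `|A ∪ (-c - B)| ≤ |G|`. [folklore] -/
theorem card_add_card_le_card_A_through_C [Fintype G] (A B : Finset G) (c : G) :
    #A + #B ≤ Fintype.card G + #(A.filter fun a => -(a + c) ∈ B) := by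
  set D := B.image fun b => -(b + c) with hD
  have hDcard : #D = #B := by
    refine card_image_of_injective _ fun b₁ b₂ hb => ?_
    have := neg_injective hb
    simpa using this
  have hinter : A.filter (fun a => -(a + c) ∈ B) = A ∩ D := by
    ext a
    simp only [mem_filter, mem_inter, hD, mem_image]
    constructor
    · rintro ⟨ha, hb⟩
      exact ⟨ha, -(a + c), hb, by abel⟩
    · rintro ⟨ha, b, hb, rfl⟩
      refine ⟨ha, ?_⟩
      have : -(-(b + c) + c) = b := by abel
      rw [this]; exact hb
  rw [hinter, ← hDcard, ← card_union_add_card_inter]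
  exact Nat.add_le_add_right (card_le_univ _) _

/-- **Dense pairs are linear.** For a trapezoid-free triple with `T` solutions,
`(#A + #B) · T ≤ |G| · T + #A · #B`: since every `C`-line carries `r(c) ≥ #A + #B - |G|` points and
`∑_c r(c)² ≤ #A · #B`.  In particular `#A + #B ≥ (1 + ε)|G|` forces `T ≤ #A·#B / (ε|G|) ≤ |G|/ε`,
and `T ≥ |G|^{1+c}` forces `#A + #B ≤ |G| + |G|^{1-c}` (likewise for the other two pairs, by
`rotate`/`swap`). [cite: Pratt2024, Prop. 3.1, Prop. 3.4] -/
theorem card_mul_le_of_dense [Fintype G] (h : IsEquilateralTrapezoidFree A B C) :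
    (#A + #B) * #(zeroSumTriples A B C) ≤
      Fintype.card G * #(zeroSumTriples A B C) + #A * #B := by
  rw [card_zeroSumTriples_eq_sum_C, mul_sum, mul_sum]
  calc ∑ c ∈ C, (#A + #B) * #(A.filter fun a => -(a + c) ∈ B)
      ≤ ∑ c ∈ C, (Fintype.card G + #(A.filter fun a => -(a + c) ∈ B)) *
          #(A.filter fun a => -(a + c) ∈ B) :=
        sum_le_sum fun c _ => Nat.mul_le_mul_right _ (card_add_card_le_card_A_through_C A B c)
    _ = ∑ c ∈ C, Fintype.card G * #(A.filter fun a => -(a + c) ∈ B) +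
          ∑ c ∈ C, #(A.filter fun a => -(a + c) ∈ B) ^ 2 := by
        rw [← sum_add_distrib]
        exact sum_congr rfl fun c _ => by ring
    _ ≤ ∑ c ∈ C, Fintype.card G * #(A.filter fun a => -(a + c) ∈ B) + #A * #B :=
        Nat.add_le_add_left (sum_sq_C_le h) _


end PrattValDisjointSquares

end Summit.MatrixMultiplication.MatrixMultiplication.Theorems
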